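import Mathlib
import Summits.NavierStokesRegularity.NavierStokesRegularity.Theorems.EulerZoomLiouvillePowerGaugeEulerLiouvilleSelfSimilarSwirlVolumeLaw
import Summits.NavierStokesRegularity.NavierStokesRegularity.Theorems.EulerZoomLiouvillePowerGaugeEulerLiouvilleSelfSimilarSwirlRatchetSlow
import HarnessLib

/-!
# Crux E `PowerGaugeEulerLiouville` (stmt-NavierStokesRegularity-19832), THE ONE STATEMENT: THE SWIRL RATCHET, IV — a FINITE SWIRL CASIMIR
# `∫|rU_θ|^p < ∞` with ONE exponent `0 < p < 3/ρ` makes the axisymmetric `C²` needle swirl-free, hence trivial (width seat ns-ezl-w3 g3)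

Route №10 `EulerZoomLiouville` (NavierStokesRegularity), crux E; LEAD ns-typeII-p2 g12.  Sequel of `…SelfSimilarSwirlVolumeLaw` (`SwirlRatchet.volume_superlevel_ratchet`:
`e^{3γs}·vol{|Γ|>μ} ≤ vol{|Γ|>μe^{−(1−2γ)s}}`, `Γ = swirl U`).  Chebyshev turns a finite swirl Casimir into the decay of the superlevel volumes:
`vol{|Γ|>μ'} ≤ μ'^{−p}∫|Γ|^p`, so `vol{|Γ|>μ} ≤ μ^{−p}(∫|Γ|^p)·e^{−(3γ − p(1−2γ))s} → 0` whenever `p(1−2γ) < 3γ` — in the class (`γ = 1/(2+ρ)`) exactly `p < 3/ρ`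
(`≥ 6` in the window):

* `SwirlRatchet.hasNoSwirl_of_null_superlevels` — a continuous swirl all of whose positive superlevel sets are null vanishes (open null sets are empty);
* `SwirlRatchet.hasNoSwirl_of_swirl_Lp` — **ONE FINITE SWIRL CASIMIR ⇒ NO SWIRL**: `γ > 0`, axisymmetric `C²` profile of linear growth, `∫⁻ |Γ|^p < ∞` with `0 < p`,
  `p(1−2γ) < 3γ` ⇒ `HasNoSwirl U`.  (Chae 2007 Thm 2.2 + «Note added» needs TWO exponents `L^{p₁} ∩ L^{p₂}`; the tree's `AxisymSelfSimilarProfile` L^{2k}-Casimir needs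
  bounded `V`, `∇V` and `2kρ ≠ 3`; here one exponent below `3/ρ`, no gradient bound.)
* MEMBER FORM `SwirlRatchet.selfSimilar_ae_eq_zero_of_axisym_LpSwirl_C2` — crux binders verbatim + exactly self-similar ansatz + `ContDiff ℝ 2 V` + `IsAxisymmetric V` + linear growth +
  `∃ p, 0 < p ∧ p < 3/ρ ∧ ∫⁻ y, ENNReal.ofReal (|swirl V y| ^ p) < ⊤` ⇒ `u = 0` a.e. ((S37) after the ratchet); PAST TWINS about any `(T, x₀)` on a window
  `τ < T₁` (`T₁ ≤ min 0 T`) of the finite-support and the Casimir members: `…_of_axisym_finiteSwirlSupport_C2_past`, `…_of_axisym_LpSwirl_C2_past`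
  (`Past.exists_isSelfSimilarEulerProfile` + (S37) past).

WHAT THIS IS NOT: not NS regularity, not the crux E — one more stratum of the crux CLASS 19832 (MODEL lattice; E/NS strata) `--supports` stmt-19832; swirl Casimirs with `p ≥ 3/ρ`
(the balanced/heavy-tail side) and the needle with no finite swirl Casimir stay OPEN.  [cite: Chae2007CMPEuler, Thm 2.1–2.2 + Note added p. 6]
-/

noncomputable section

-- flat `Theorems/<Route><Decl>…` files of one crux share the namespace of the crux (tree convention: `Summit.<S>.<S>.…`)
set_option linter.dupNamespace false

open MeasureTheory Set Filter Topology Metric Function InnerProductSpace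
open scoped RealInnerProductSpace NNReal ContDiff

namespace Summit.NavierStokesRegularity.NavierStokesRegularity.Theorems.PowerGaugeEulerLiouville

open Literature.Analysis Literature.Analysis.FluidPDE Literature.Analysis.FunctionSpaces

namespace SwirlRatchet

variable {γ : ℝ} {U : EuclideanSpace ℝ (Fin 3) → EuclideanSpace ℝ (Fin 3)} {P : EuclideanSpace ℝ (Fin 3) → ℝ}

/-- **A continuous swirl with null positive superlevel sets vanishes**: if `vol{y | μ < |Γ y|} = 0` for every `μ > 0` then `Γ ≡ 0` (the superlevel sets are open,
and Lebesgue-null open sets are empty). [folklore] -/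
theorem hasNoSwirl_of_null_superlevels (hUc : Continuous U)
    (hnull : ∀ μ : ℝ, 0 < μ → volume {y : EuclideanSpace ℝ (Fin 3) | μ < |swirl U y|} = 0) : HasNoSwirl U := by
  have hΓc : Continuous (swirl U) := by
    rw [swirl_eq_inner_rotGen]
    exact (rotGenL.continuous.congr fun y => rotGenL_apply y).inner hUc
  intro y
  by_contra hne
  have hμ : 0 < |swirl U y| / 2 := by positivity
  have hopen : IsOpen {z : EuclideanSpace ℝ (Fin 3) | |swirl U y| / 2 < |swirl U z|} :=
    isOpen_lt continuous_const (continuous_abs.comp hΓc)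
  have hempty := (hopen.measure_eq_zero_iff volume).1 (hnull _ hμ)
  have hy : y ∈ {z : EuclideanSpace ℝ (Fin 3) | |swirl U y| / 2 < |swirl U z|} := by
    show |swirl U y| / 2 < |swirl U y|
    linarith [abs_pos.2 hne]
  rw [hempty] at hy
  exact hy

/-- **Chebyshev for the swirl**: `ofReal(μ^p) · vol{μ < |Γ|} ≤ ∫⁻ ofReal(|Γ|^p)` for `μ > 0`, `p > 0`. [folklore] -/
theorem ofReal_rpow_mul_volume_superlevel_le (hUc : Continuous U) {p μ : ℝ} (hp : 0 < p) (hμ : 0 < μ) :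
    ENNReal.ofReal (μ ^ p) * volume {y : EuclideanSpace ℝ (Fin 3) | μ < |swirl U y|} ≤
      ∫⁻ y, ENNReal.ofReal (|swirl U y| ^ p) := by
  have hΓc : Continuous (swirl U) := by
    rw [swirl_eq_inner_rotGen]
    exact (rotGenL.continuous.congr fun y => rotGenL_apply y).inner hUc
  have hfm : AEMeasurable (fun y : EuclideanSpace ℝ (Fin 3) => ENNReal.ofReal (|swirl U y| ^ p)) volume :=
    (ENNReal.continuous_ofReal.comp ((continuous_abs.comp hΓc).rpow_const fun _ => Or.inr hp.le)).measurable.aemeasurable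
  refine le_trans ?_ (mul_meas_ge_le_lintegral₀ hfm (ENNReal.ofReal (μ ^ p)))
  exact mul_le_mul' le_rfl (measure_mono fun y hy =>
    ENNReal.ofReal_le_ofReal (Real.rpow_le_rpow hμ.le (le_of_lt hy) hp.le))

/-- **ONE FINITE SWIRL CASIMIR ⇒ NO SWIRL.**  `(U, P)` a `C²` self-similar Euler profile (CIV (3.3)), `γ > 0`, `U` axisymmetric of linear growth `‖U y‖ ≤ K₁(1+‖y‖)`,
and `∫⁻ |Γ|^p < ∞` for ONE exponent `0 < p` with `p(1−2γ) < 3γ` (`Γ = swirl U = rU_θ`).  Then `U` is swirl-free.  (Volume law + Chebyshev: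
`e^{3γs} vol{|Γ|>μ} ≤ vol{|Γ|>μe^{−(1−2γ)s}} ≤ (μe^{−(1−2γ)s})^{−p}∫|Γ|^p`, i.e. `vol{|Γ|>μ} ≤ μ^{−p}(∫|Γ|^p) e^{−(3γ−p(1−2γ))s} → 0`.)
[cite: Chae2007CMPEuler, Thm 2.1–2.2 + Note added p. 6] -/
theorem hasNoSwirl_of_swirl_Lp (h : IsSelfSimilarEulerProfile γ 0 U P) (hU : IsAxisymmetric U) (hγ : 0 < γ)
    {K₁ : ℝ} (hlin : ∀ y, ‖U y‖ ≤ K₁ * (1 + ‖y‖)) {p : ℝ} (hp : 0 < p) (hpq : p * (1 - 2 * γ) < 3 * γ)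
    (hI : ∫⁻ y, ENNReal.ofReal (|swirl U y| ^ p) < ⊤) : HasNoSwirl U := by
  have hUc : Continuous U := h.contDiff_velocity.continuous
  set I : ENNReal := ∫⁻ y, ENNReal.ofReal (|swirl U y| ^ p) with hIdef
  refine hasNoSwirl_of_null_superlevels hUc fun μ hμ => ?_
  set v : ENNReal := volume {y : EuclideanSpace ℝ (Fin 3) | μ < |swirl U y|} with hv
  set δ : ℝ := 3 * γ - p * (1 - 2 * γ) with hδ
  have hδ0 : 0 < δ := by rw [hδ]; linarith
  -- for every `s ≥ 0`: `μ^p e^{δ s} v ≤ I` (in `ℝ`)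
  have hbound : ∀ s : ℝ, 0 ≤ s → μ ^ p * Real.exp (δ * s) * v.toReal ≤ I.toReal := by
    intro s hs
    set μ' : ℝ := μ * Real.exp (-((1 - 2 * γ) * s)) with hμ'
    have hμ'0 : 0 < μ' := by rw [hμ']; positivity
    have hlaw := volume_superlevel_ratchet h hU hγ hlin μ hs
    have hcheb := ofReal_rpow_mul_volume_superlevel_le hUc hp hμ'0
    -- combine: `ofReal(μ'^p) * ofReal(e^{3γs}) * v ≤ I`
    have h1 : ENNReal.ofReal (μ' ^ p) * (ENNReal.ofReal (Real.exp (3 * γ * s)) * v) ≤ I :=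
      le_trans (mul_le_mul' le_rfl hlaw) hcheb
    have h2 : ENNReal.ofReal (μ' ^ p) * (ENNReal.ofReal (Real.exp (3 * γ * s)) * v) ≠ ⊤ := ne_top_of_le_ne_top hI.ne h1
    have h3 := ENNReal.toReal_mono hI.ne h1
    rw [ENNReal.toReal_mul, ENNReal.toReal_mul, ENNReal.toReal_ofReal (Real.rpow_nonneg hμ'0.le _),
      ENNReal.toReal_ofReal (Real.exp_pos _).le] at h3
    -- `μ'^p e^{3γ s} = μ^p e^{δ s}`
    have h4 : μ' ^ p * Real.exp (3 * γ * s) = μ ^ p * Real.exp (δ * s) := by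
      rw [hμ', Real.mul_rpow hμ.le (Real.exp_pos _).le, ← Real.exp_mul, mul_assoc, ← Real.exp_add]
      congr 1; congr 1; rw [hδ]; ring
    calc μ ^ p * Real.exp (δ * s) * v.toReal = μ' ^ p * Real.exp (3 * γ * s) * v.toReal := by rw [h4]
      _ = μ' ^ p * (Real.exp (3 * γ * s) * v.toReal) := by ring
      _ ≤ I.toReal := h3
  -- `v` is finite (`s = 0`) and then zero
  have hvtop : v ≠ ⊤ := by
    have hcheb := ofReal_rpow_mul_volume_superlevel_le hUc hp hμ
    have hμp : ENNReal.ofReal (μ ^ p) ≠ 0 := by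
      rw [Ne, ENNReal.ofReal_eq_zero, not_le]; exact Real.rpow_pos_of_pos hμ _
    intro htop
    rw [← hv, htop, ENNReal.mul_top hμp] at hcheb
    exact absurd (le_antisymm le_top hcheb) hI.ne
  by_contra hv0
  have hvpos : 0 < v.toReal := ENNReal.toReal_pos hv0 hvtop
  have hμp : 0 < μ ^ p := Real.rpow_pos_of_pos hμ _
  set a : ℝ := μ ^ p * v.toReal with ha
  have ha0 : 0 < a := by rw [ha]; positivity
  -- choose `s` with `e^{δ s} > I.toReal / a`
  set s : ℝ := (I.toReal / a + 1) / δ with hsdef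
  have hs0 : 0 ≤ s := by rw [hsdef]; positivity
  have hexp : I.toReal / a + 1 < Real.exp (δ * s) := by
    have h1 : δ * s = I.toReal / a + 1 := by rw [hsdef]; field_simp
    rw [h1]
    linarith [Real.add_one_le_exp (I.toReal / a + 1)]
  have h2 : I.toReal < a * Real.exp (δ * s) := by
    have h3 : I.toReal < a * (I.toReal / a + 1) := by
      rw [mul_add, mul_div_cancel₀ _ ha0.ne', mul_one]; linarith
    exact h3.trans (mul_lt_mul_of_pos_left hexp ha0)
  have h4 := hbound s hs0
  have h5 : μ ^ p * Real.exp (δ * s) * v.toReal = a * Real.exp (δ * s) := by rw [ha]; ring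
  linarith

/-- In the class: `γ = 1/(2+ρ)`, `ρ > 0`: `p(1−2γ) < 3γ ⟺ p < 3/ρ`. [folklore] -/
theorem exponent_gap_of_lt {ρ p : ℝ} (hρ : 0 < ρ) (hp3 : p < 3 / ρ) :
    p * (1 - 2 * (1 / (2 + ρ))) < 3 * (1 / (2 + ρ)) := by
  have h2ρ : (0 : ℝ) < 2 + ρ := by linarith
  have h1 : p * ρ < 3 := (lt_div_iff₀ hρ).1 hp3
  have e1 : p * (1 - 2 * (1 / (2 + ρ))) = p * ρ / (2 + ρ) := by field_simp; ring
  have e2 : 3 * (1 / (2 + ρ)) = 3 / (2 + ρ) := by ring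
  rw [e1, e2]
  exact div_lt_div_of_pos_right h1 h2ρ

end SwirlRatchet

/-! ### Member form -/

namespace SwirlRatchet

variable {u : ℝ → EuclideanSpace ℝ (Fin 3) → EuclideanSpace ℝ (Fin 3)} {p : ℝ → EuclideanSpace ℝ (Fin 3) → ℝ}
  {H : ℝ → EuclideanSpace ℝ (Fin 3) → EuclideanSpace ℝ (Fin 3) →L[ℝ] EuclideanSpace ℝ (Fin 3)} {c : ℝ≥0}
  {V : EuclideanSpace ℝ (Fin 3) → EuclideanSpace ℝ (Fin 3)} {P : EuclideanSpace ℝ (Fin 3) → ℝ}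

/-- **MEMBER FORM: AXISYMMETRIC `C²` PROFILE OF LINEAR GROWTH WITH ONE FINITE SWIRL CASIMIR ⇒ TRIVIAL.**  Crux binders verbatim (`0 < ρ ≤ ½`) + exactly self-similar ansatz
about the origin + `ContDiff ℝ 2 V` + `IsAxisymmetric V` + `‖V y‖ ≤ K₁(1+‖y‖)` + `∫⁻ ofReal(|swirl V|^q) < ⊤` for one `0 < q < 3/ρ` ⇒ `u = 0` a.e.  (Classical pressure of
the profile, the Casimir kill, then (S37) `NeedleRace.selfSimilar_ae_eq_zero_of_axisymNoSwirlC2`.) [cite: Chae2007CMPEuler, Thm 2.1–2.2 + Note added p. 6] -/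
theorem selfSimilar_ae_eq_zero_of_axisym_LpSwirl_C2 {ρ : ℝ} (hρ : 0 < ρ) (hρ1 : ρ ≤ 1 / 2)
    (hsw : IsSuitableWeakSolutionOn (slab (EuclideanSpace ℝ (Fin 3)) (Iio 0) isOpen_Iio) 0 0 u p)
    (hH : HasWeakSpatialGradientOn (slab (EuclideanSpace ℝ (Fin 3)) (Iio 0) isOpen_Iio) u H)
    (hgauge : ∀ a : ℝ, 0 < a →
      ENNReal.ofReal (a ^ (2 * ρ)) * cknA a (0 : ℝ × EuclideanSpace ℝ (Fin 3)) u +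
          ENNReal.ofReal (a ^ ρ) * cknE a (0 : ℝ × EuclideanSpace ℝ (Fin 3)) H +
        ENNReal.ofReal (a ^ (2 * ρ)) * cknD a (0 : ℝ × EuclideanSpace ℝ (Fin 3)) p ≤ (c : ENNReal))
    (hu : ∀ τ : ℝ, τ < 0 → u τ = selfSimilarCollapse (1 / (2 + ρ)) 0 V τ)
    (hp : ∀ τ : ℝ, τ < 0 → p τ = selfSimilarCollapsePressure (1 / (2 + ρ)) 0 P τ)
    (hV : ContDiff ℝ 2 V) (hax : IsAxisymmetric V)
    (hlin : ∃ K₁ : ℝ, ∀ y, ‖V y‖ ≤ K₁ * (1 + ‖y‖))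
    (hLp : ∃ q : ℝ, 0 < q ∧ q < 3 / ρ ∧ ∫⁻ y, ENNReal.ofReal (|swirl V y| ^ q) < ⊤) :
    uncurry u =ᵐ[volume.restrict (Iio (0 : ℝ) ×ˢ (univ : Set (EuclideanSpace ℝ (Fin 3))))] 0 := by
  obtain ⟨K₁, hK₁⟩ := hlin
  obtain ⟨q, hq, hq3, hI⟩ := hLp
  have hρ1' : ρ < 1 := by linarith
  have h2ρ : (0 : ℝ) < 2 + ρ := by linarith
  have hγ : (0 : ℝ) < 1 / (2 + ρ) := one_div_pos.2 h2ρ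
  -- a classical pressure of the profile (boilerplate of the lineage's member theorems)
  have hD : ∀ a : ℝ, 0 < a → ENNReal.ofReal (a ^ (2 * ρ)) *
      cknD a (0 : ℝ × EuclideanSpace ℝ (Fin 3)) p ≤ (c : ENNReal) :=
    fun a ha => le_trans le_add_self (hgauge a ha)
  have hpm : AEStronglyMeasurable (uncurry p)
      (volume.restrict (Iio (0 : ℝ) ×ˢ (univ : Set (EuclideanSpace ℝ (Fin 3))))) := by
    have := hsw.distributional.2.2.1.aestronglyMeasurable
    simpa [slab] using this
  have hPm := aestronglyMeasurable_pressureProfile hpm hp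
  have hDprof := profile_pressure_weight_of_gaugeD hρ hρ1' hpm hp hD
  have hP1 : LocallyIntegrable P volume :=
    EnergySaturation.locallyIntegrable_pressure_of_weight hρ1' hPm
      (ENNReal.mul_ne_top ENNReal.ofReal_ne_top ENNReal.coe_ne_top) hDprof
  obtain ⟨P', hprof⟩ := WeakToClassical.exists_isSelfSimilarEulerProfile_of_contDiff hsw.distributional hu hp hV hP1
  have hns : HasNoSwirl V := hasNoSwirl_of_swirl_Lp hprof hax hγ hK₁ hq (exponent_gap_of_lt hρ hq3) hI
  exact NeedleRace.selfSimilar_ae_eq_zero_of_axisymNoSwirlC2 hρ hρ1 hsw hH hgauge hu hp hV hax hns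

/-- **PAST TWIN of `selfSimilar_ae_eq_zero_of_axisym_finiteSwirlSupport_C2`** (velocity and pressure exactly self-similar about `(T, x₀)` for `τ < T₁`, `T₁ ≤ 0`, `T₁ ≤ T`;
axisymmetric `C²` profile of linear growth with finite-volume swirl support ⇒ trivial). [cite: Chae2007CMPEuler, Thm 2.2 + Note added p. 6] -/
theorem selfSimilar_ae_eq_zero_of_axisym_finiteSwirlSupport_C2_past {ρ T T₁ : ℝ} (hρ : 0 < ρ) (hρ1 : ρ ≤ 1 / 2)
    (hT₁ : T₁ ≤ 0) (hTT₁ : T₁ ≤ T) (x₀ : EuclideanSpace ℝ (Fin 3))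
    (hsw : IsSuitableWeakSolutionOn (slab (EuclideanSpace ℝ (Fin 3)) (Iio 0) isOpen_Iio) 0 0 u p)
    (hH : HasWeakSpatialGradientOn (slab (EuclideanSpace ℝ (Fin 3)) (Iio 0) isOpen_Iio) u H)
    (hgauge : ∀ a : ℝ, 0 < a →
      ENNReal.ofReal (a ^ (2 * ρ)) * cknA a (0 : ℝ × EuclideanSpace ℝ (Fin 3)) u +
          ENNReal.ofReal (a ^ ρ) * cknE a (0 : ℝ × EuclideanSpace ℝ (Fin 3)) H +
        ENNReal.ofReal (a ^ (2 * ρ)) * cknD a (0 : ℝ × EuclideanSpace ℝ (Fin 3)) p ≤ (c : ENNReal))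
    (hu : ∀ τ : ℝ, τ < T₁ → u τ = fun x => selfSimilarCollapse (1 / (2 + ρ)) T V τ (x - x₀))
    (hp : ∀ τ : ℝ, τ < T₁ → p τ = fun x => selfSimilarCollapsePressure (1 / (2 + ρ)) T P τ (x - x₀))
    (hV : ContDiff ℝ 2 V) (hax : IsAxisymmetric V)
    (hlin : ∃ K₁ : ℝ, ∀ y, ‖V y‖ ≤ K₁ * (1 + ‖y‖))
    (hfin : volume {y : EuclideanSpace ℝ (Fin 3) | swirl V y ≠ 0} < ⊤) :
    uncurry u =ᵐ[volume.restrict (Iio (0 : ℝ) ×ˢ (univ : Set (EuclideanSpace ℝ (Fin 3))))] 0 := by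
  obtain ⟨K₁, hK₁⟩ := hlin
  have h2ρ : (0 : ℝ) < 2 + ρ := by linarith
  have hγ : (0 : ℝ) < 1 / (2 + ρ) := one_div_pos.2 h2ρ
  obtain ⟨P', hprof⟩ := Past.exists_isSelfSimilarEulerProfile hρ hT₁ hTT₁ hsw.distributional hu hp hV
  have hns : HasNoSwirl V := hasNoSwirl_of_finite_swirlSupport hprof hax hγ hK₁ hfin
  exact NeedleRace.selfSimilar_ae_eq_zero_of_axisymNoSwirlC2_past hρ hρ1 hT₁ hTT₁ x₀ hsw hH hgauge hu hp hV hax hns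

/-- **PAST TWIN of `selfSimilar_ae_eq_zero_of_axisym_LpSwirl_C2`** (same window shape; one finite swirl Casimir `∫⁻ ofReal(|swirl V|^q) < ⊤`, `0 < q < 3/ρ`).
[cite: Chae2007CMPEuler, Thm 2.1–2.2 + Note added p. 6] -/
theorem selfSimilar_ae_eq_zero_of_axisym_LpSwirl_C2_past {ρ T T₁ : ℝ} (hρ : 0 < ρ) (hρ1 : ρ ≤ 1 / 2)
    (hT₁ : T₁ ≤ 0) (hTT₁ : T₁ ≤ T) (x₀ : EuclideanSpace ℝ (Fin 3))
    (hsw : IsSuitableWeakSolutionOn (slab (EuclideanSpace ℝ (Fin 3)) (Iio 0) isOpen_Iio) 0 0 u p)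
    (hH : HasWeakSpatialGradientOn (slab (EuclideanSpace ℝ (Fin 3)) (Iio 0) isOpen_Iio) u H)
    (hgauge : ∀ a : ℝ, 0 < a →
      ENNReal.ofReal (a ^ (2 * ρ)) * cknA a (0 : ℝ × EuclideanSpace ℝ (Fin 3)) u +
          ENNReal.ofReal (a ^ ρ) * cknE a (0 : ℝ × EuclideanSpace ℝ (Fin 3)) H +
        ENNReal.ofReal (a ^ (2 * ρ)) * cknD a (0 : ℝ × EuclideanSpace ℝ (Fin 3)) p ≤ (c : ENNReal))
    (hu : ∀ τ : ℝ, τ < T₁ → u τ = fun x => selfSimilarCollapse (1 / (2 + ρ)) T V τ (x - x₀))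
    (hp : ∀ τ : ℝ, τ < T₁ → p τ = fun x => selfSimilarCollapsePressure (1 / (2 + ρ)) T P τ (x - x₀))
    (hV : ContDiff ℝ 2 V) (hax : IsAxisymmetric V)
    (hlin : ∃ K₁ : ℝ, ∀ y, ‖V y‖ ≤ K₁ * (1 + ‖y‖))
    (hLp : ∃ q : ℝ, 0 < q ∧ q < 3 / ρ ∧ ∫⁻ y, ENNReal.ofReal (|swirl V y| ^ q) < ⊤) :
    uncurry u =ᵐ[volume.restrict (Iio (0 : ℝ) ×ˢ (univ : Set (EuclideanSpace ℝ (Fin 3))))] 0 := by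
  obtain ⟨K₁, hK₁⟩ := hlin
  obtain ⟨q, hq, hq3, hI⟩ := hLp
  have h2ρ : (0 : ℝ) < 2 + ρ := by linarith
  have hγ : (0 : ℝ) < 1 / (2 + ρ) := one_div_pos.2 h2ρ
  obtain ⟨P', hprof⟩ := Past.exists_isSelfSimilarEulerProfile hρ hT₁ hTT₁ hsw.distributional hu hp hV
  have hns : HasNoSwirl V := hasNoSwirl_of_swirl_Lp hprof hax hγ hK₁ hq (exponent_gap_of_lt hρ hq3) hI
  exact NeedleRace.selfSimilar_ae_eq_zero_of_axisymNoSwirlC2_past hρ hρ1 hT₁ hTT₁ x₀ hsw hH hgauge hu hp hV hax hns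

end SwirlRatchet

end Summit.NavierStokesRegularity.NavierStokesRegularity.Theorems.PowerGaugeEulerLiouville

end
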